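import Literature.Probability.LatticeModels.HardCoreUrsell
import Literature.MathematicalPhysics.QuantumFieldTheory.BalabanImbrieJaffe1984to88.BIJ88Sect5StatementsPart4
import Literature.Probability.LatticeModels.UrsellExplicitFormula

/-!
# `BalabanImbrieJaffe1984to88.BIJ88TruncatedExpectation5142` — T. Bałaban, J. Imbrie, A. Jaffe, *Effective action and cluster
properties of the abelian Higgs model*, Commun. Math. Phys. **114** (1988) 257–315 [BalabanImbrieJaffe1988], Sect. 5.14:
**the truncated expectation `⟨d/dt; …; d/dt⟩_t` of (5.14.2) IS `(d/dt)ⁿ log z_t`** — the truncated functions DEFINED by the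
moment–truncation relation of p. 310 (display 2) from the derivative moments `⟨(d/dt)^j⟩_t = z_t^{(j)}/z_t` are unique and equal
the derivatives of `log z_t`, for ANY positive `Cⁿ` function `z`; and the kernel side of the `(n̄+1)!`-versus-`n̄!` question in the
printed remainder (5.14.2).

statement-level skeleton of published theorems with citation tags; proofs where landed; nothing here is a claim about the Yang–Mills mass gap

THE PRINT (verbatim; p. 308 = PDF 52 read as the image `lit-balaban-r16/renders/cmp114/original-p052-x2.png`, p. 310 = PDF 54 rendered
and read as an image this session, `renders/original-p054-x2.png` of the p36 seat).  p. 308: *"Thus we define perturbative terms for the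
action, 𝒫̃_{k+1}(Λ₁₂^{(k)}) = Σ_{α=1}^{n̄} −(1/α!)(dᵅ/dtᵅ) log z_t(Λ₁₂^{(k)})|_{t=0}, and a remainder
ℛ_k(Λ₁₂^{(k)}) = ∫₀¹ dt −((1−t)^{n̄}/(n̄+1)!) ⟨d/dt; …; d/dt⟩_t. (5.14.2) Here ⟨·⟩_t is the interacting expectation
⟨·⟩_t = z_t(Λ₁₂^{(k)})⁻¹ ⟨· χ′_{Λ₁₂^{(k)},t} e^{−tṼ^{(k)}(Λ₁₂^{(k)})}⟩_{1,Λ₁₂^{(k)}} … We express each d/dt as a sum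
Σ_γ (d/dt)_γ … We cluster expand as before each integral making up the truncated expectation values
⟨(d/dt)_{γ_1}; …; (d/dt)_{γ_{n̄+1}}⟩_t."*  p. 310,
display 2: *"The connected components of G define a partition of H which corresponds to the partition in the formula
⟨Π_{j∈H}(d/dt)_{γ_j}⟩_t = Σ_{{H_τ}∈𝒫(H)} Π_τ ⟨Π_{j∈H_τ}[;(d/dt)_{γ_j}]⟩_t."* — the truncated (connected) expectations are the
solution of the moment–truncation relations over the SET PARTITIONS `𝒫(H)`; (5.14.2) uses them for `n̄ + 1` insertions of `d/dt`,
whose untruncated expectations are `⟨(d/dt)^j⟩_t = z_t^{(j)}/z_t` (the `j`-th `t`-derivative under the integral, normalized — this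
seat's `BIJ88RestrictionsAllOrders308` / `BIJ88RestrictedInteractionAllOrders308` for the concrete family).

WHAT IS PROVED (theorems only; no `def`, no `Prop` fact; set partitions = `Literature.Probability.LatticeModels.setPartitions`,
the finset of set partitions bridged to Mathlib's `Finpartition` in `HardCoreUrsell`).
* §1 **Uniqueness** (`trunc_unique`): two families `κ₁, κ₂` solving `m(K) = Σ_{π∈𝒫(K)} Π_{B∈π} κ(B)` for all nonempty `K ⊆ V` agree
  on those `K` (strong induction on `|K|`, splitting off the one-block partition) — display 2 DEFINES the truncated functions.
* §2 **The exponential formula for derivative moments** (`iteratedDerivWithin_eq_mul_sum_setPartitions`): for `z > 0` of class `Cⁿ`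
  within a set `s` of unique differentiability (e.g. `[0,1]`, one-sided derivatives at the ends) and `t ∈ s`,
  `z^{(|V|)}(t) = z(t) · Σ_{π∈𝒫(V)} Π_{B∈π} (log z)^{(|B|)}(t)` (`|V| ≤ n`) — by the Leibniz recursion
  `z^{(m+1)} = Σ_i C(m,i) z^{(i)} (log z)^{(m−i+1)}` (`iteratedDerivWithin_succ_eq_sum_choose_log`, from `z′ = z (log z)′` and Mathlib's
  `iteratedDerivWithin_mul`) matched against the marked-block decomposition `HardCoreUrsell.sum_setPartitions_eq_sum_block` and
  Mathlib's `Finset.sum_powerset_apply_card`.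
* §3 **Identification** (`trunc_eq_iteratedDerivWithin_log`, `…_log'`, `trunc_top_eq_iteratedDerivWithin_log`): every solution `κ`
  of display 2 against the moments `z^{(|K|)}(t)/z(t)` satisfies `κ(K) = (log z)^{(|K|)}(t)`; in particular
  «`⟨d/dt; …; d/dt⟩_t` (`n` entries) `= (d/dt)ⁿ log z_t`».
* §4 **(5.14.2)** on `[0,1]` with `H` a set of `n̄ + 1` labels (`trunc_univ_eq_iteratedDerivWithin_log`): with the row owner's
  (r16) typed `BIJ88Sect5StatementsPart4.remR` / `pertP` / `taylor_logz`, **`remR_trunc_eq`**: `ℛ_k` AS PRINTED (weight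
  `(1−t)^{n̄}/(n̄+1)!`) fed with the display-2 truncated expectation equals `−(1/(n̄+1))·∫₀¹((1−t)^{n̄}/n̄!)(d/dt)^{n̄+1} log z_t dt`,
  hence **`logz_split_trunc`**: `log z₁ = log z₀ − 𝒫̃_{k+1} − (n̄+1)·ℛ_k^{printed}`, and **`eq5142_taylorWeight`**: with the weight
  `(1−t)^{n̄}/n̄!` the split `log z₁ = log z₀ − 𝒫̃_{k+1} − ℛ_k` holds exactly.  This is the kernel side of the TRANSCRIPTION NOTE
  recorded (not adjudicated) by the row owner in the docstring of `BIJ88Sect5StatementsPart4.remR` — *"with the standard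
  identification ⟨d/dt;…;d/dt⟩_t (n̄+1 entries) = d^{n̄+1}/dt^{n̄+1} log z_t, Taylor's formula has the weight (1−t)^{n̄}/n̄!; the
  printed (n̄+1)! presumes a truncated expectation larger by the factor n̄+1"*: §3 PROVES that identification from the paper's own
  definition of `⟨;⟩_t` (p. 310 display 2), so r16's `logz_split` hypothesis `htr` holds up to exactly the located factor `n̄ + 1`.
  Ruling (print slip vs. convention) is the owner's (r16, C2 §5); a GAPS.md entry text is proposed with this file.
* §5 (v1.1) **bridge to `Literature.Probability.LatticeModels`** (Ruelle's Möbius inversion `ursellOf`):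
  **`ursellOf_derivMoments_eq_iteratedDerivWithin_log`** — the display-2 truncated function of the derivative moments IS their Ursell
  function, `ursellOf (K ↦ z^{(|K|)}(t)/z(t)) K = (log z)^{(|K|)}(t)`; and **EXPLICITLY at all orders**
  **`iteratedDerivWithin_log_eq_sum_setPartitions_moebius`** / `…_fin`:
  `(log z)^{(n)}(t) = Σ_{π ∈ 𝒫({1,…,n})} (−1)^{|π|−1}(|π|−1)! Π_{P∈π} z^{(|P|)}(t)/z(t)` (`n ≥ 1`; Faà di Bruno for `log ∘ z` in
  set-partition form, via `LatticeModels.ursellOf_eq_sum_setPartitions`).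

HONEST SCOPE / READINGS.  (a) `⟨(d/dt)^j⟩_t := z_t^{(j)}/z_t` — the normalized `j`-th `t`-derivative of the integrand, i.e. the sum
over assignments `γ` of `⟨Π_j (d/dt)_{γ_j}⟩_t` (p. 308 *"We express each d/dt as a sum Σ_γ (d/dt)_γ"*, Leibniz; the assignment
bookkeeping is p25's `BIJ88Expansion5143`, not repeated here); by multilinearity and §1 the assignment-summed truncated expectation is
then the display-2 truncation of these moments — this file works at the summed level.  (b) Derivatives are `iteratedDerivWithin … s`,
`s` any set with `UniqueDiffOn` (for §4: `Set.uIcc 0 1`, as in r16's `pertP`/`taylor_logz`).  (c) `z > 0` on `s` (for the family of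
p. 308: this seat's `BIJ88ZtPositivity308`; the instance is the sibling file `BIJ88TruncatedExpectation5142Family`).  (d) Nothing of
(5.14.3)/(5.14.4) is used or asserted.  0 `sorry`; axioms standard.

CITATION HEADER (lean-in-tree rule).  Part of the lit-balaban TYPED SKELETON (HOME `run/shared/lean/pub/lit-balaban/`), Phase 2,
seat p36 (gen 9, unit `lit-balaban-p36`); rows **C2.Eq5.14.1-5.14.2** (member (5.14.2)) and **C2.Claim@310** (p. 310 display 2) of
`HOME/lit-balaban-r16/ROWS-C2-part2.md` (owner r16; heads untouched).  PDF held: `paper:balaban1988-cmp114-bij-abelian-higgs-effective-action`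
(journal page = PDF page + 256).  NOT summit progress; NOT a claim about the continuum or the mass gap.
-/

open Finset MeasureTheory
open Literature.Probability.LatticeModels (IsSetPartition setPartitions mem_setPartitions isSetPartition_singleton
  setPartitions_empty sum_setPartitions_eq_sum_block)
open Literature.MathematicalPhysics.QuantumFieldTheory.BalabanImbrieJaffe1984to88.BIJ88Sect5StatementsPart4
  (pertP remR taylor_logz)

namespace Literature.MathematicalPhysics.QuantumFieldTheory.BalabanImbrieJaffe1984to88.BIJ88TruncatedExpectation5142

/-! ## §1 Truncated functions: the moment–truncation relation over set partitions, and its unique solvability -/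

section Algebra

variable {α : Type*} [DecidableEq α] {R : Type*} [CommRing R]

/-- Splitting off the one-block partition `{K}`: `Σ_{π ∈ 𝒫(K)} g π = g {K} + Σ_{π ≠ {K}} g π` (`K ≠ ∅`).
[cite: BalabanImbrieJaffe1988, p.310 display 2] -/
theorem sum_setPartitions_eq_add_sum_erase {K : Finset α} (hK : K.Nonempty) {M : Type*} [AddCommMonoid M]
    (g : Finset (Finset α) → M) :
    ∑ π ∈ setPartitions K, g π = g {K} + ∑ π ∈ (setPartitions K).erase {K}, g π :=
  (add_sum_erase _ g (mem_setPartitions.2 (isSetPartition_singleton hK))).symm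

/-- **Uniqueness of the truncated functions.** Two families `κ₁, κ₂` solving the moment–truncation relations
`m(K) = Σ_{π ∈ 𝒫(K)} Π_{B ∈ π} κ(B)` for all nonempty `K ⊆ V` (p. 310 display 2, read as the DEFINITION of the truncated
expectations `⟨…;…⟩_t`) agree on every nonempty `K ⊆ V`. [cite: BalabanImbrieJaffe1988, p.310 display 2] -/
theorem trunc_unique {V : Finset α} {m κ₁ κ₂ : Finset α → R}
    (h₁ : ∀ K ⊆ V, K.Nonempty → m K = ∑ π ∈ setPartitions K, ∏ B ∈ π, κ₁ B)
    (h₂ : ∀ K ⊆ V, K.Nonempty → m K = ∑ π ∈ setPartitions K, ∏ B ∈ π, κ₂ B) :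
    ∀ K ⊆ V, K.Nonempty → κ₁ K = κ₂ K := by
  suffices H : ∀ n (K : Finset α), K.card = n → K ⊆ V → K.Nonempty → κ₁ K = κ₂ K from
    fun K hKV hK => H _ K rfl hKV hK
  intro n
  induction n using Nat.strong_induction_on with
  | _ n ih =>
    intro K hcard hKV hK
    have e₁ := h₁ K hKV hK
    have e₂ := h₂ K hKV hK
    rw [sum_setPartitions_eq_add_sum_erase hK, prod_singleton] at e₁ e₂
    have hrest : ∑ π ∈ (setPartitions K).erase {K}, ∏ B ∈ π, κ₁ B
        = ∑ π ∈ (setPartitions K).erase {K}, ∏ B ∈ π, κ₂ B := by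
      refine sum_congr rfl fun π hπ => prod_congr rfl fun B hB => ?_
      obtain ⟨hne, hπ⟩ := mem_erase.1 hπ
      have hP := mem_setPartitions.1 hπ
      have hBK : B ⊂ K := hP.ssubset_of_ne_singleton hne hB
      exact ih B.card (hcard ▸ card_lt_card hBK) B rfl (hBK.subset.trans hKV) (hP.nonempty_of_mem hB)
    rw [hrest] at e₁
    exact add_right_cancel (e₁.symm.trans e₂)

end Algebra


/-! ## §2 The exponential formula: derivative moments are partition sums of the log-derivatives -/

section Analysis

variable {α : Type*} [DecidableEq α]

/-- Re-indexing the blocks through a marked element: `Σ_{P ⊆ V, v ∈ P} g(P) = Σ_{P' ⊆ V∖{v}} g(P' ∪ {v})`.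
[cite: BalabanImbrieJaffe1988, p.310 display 2] -/
theorem sum_powerset_filter_mem_eq {M : Type*} [AddCommMonoid M] {V : Finset α} {v : α} (hv : v ∈ V)
    (g : Finset α → M) :
    ∑ P ∈ V.powerset.filter (fun P => v ∈ P), g P = ∑ P ∈ (V.erase v).powerset, g (insert v P) := by
  refine sum_nbij' (fun P => P.erase v) (fun P => insert v P) ?_ ?_ ?_ ?_ ?_
  · intro P hP
    simp only [mem_filter, mem_powerset] at hP
    exact mem_powerset.2 (erase_subset_erase v hP.1)
  · intro P hP
    rw [mem_powerset] at hP
    simp only [mem_filter, mem_powerset]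
    exact ⟨insert_subset hv (hP.trans (erase_subset v V)), mem_insert_self v P⟩
  · intro P hP
    simp only [mem_filter] at hP
    exact insert_erase hP.2
  · intro P hP
    rw [mem_powerset] at hP
    exact erase_insert fun h => notMem_erase v V (hP h)
  · intro P hP
    simp only [mem_filter] at hP
    rw [insert_erase hP.2]

/-- **Leibniz recursion for the derivative moments.** For `z > 0` of class `Cⁿ` within `s` and `m + 1 ≤ n`:
`z^{(m+1)} = Σ_{i=0}^{m} C(m,i) z^{(i)} (log z)^{(m−i+1)}` (from `z′ = z·(log z)′` and the Leibniz rule) — the analytic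
recursion matching the marked-block recursion of the set partitions. [cite: BalabanImbrieJaffe1988, (5.14.2) p.308] -/
theorem iteratedDerivWithin_succ_eq_sum_choose_log {s : Set ℝ} (hs : UniqueDiffOn ℝ s) {t : ℝ} (ht : t ∈ s)
    {z : ℝ → ℝ} {n : ℕ} (hz : ContDiffOn ℝ n z s) (hpos : ∀ x ∈ s, 0 < z x) {m : ℕ} (hmn : m + 1 ≤ n) :
    iteratedDerivWithin (m + 1) z s t = ∑ i ∈ range (m + 1),
      (m.choose i : ℝ) * iteratedDerivWithin i z s t *
        iteratedDerivWithin (m - i + 1) (fun x => Real.log (z x)) s t := by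
  have hne : ∀ x ∈ s, z x ≠ 0 := fun x hx => (hpos x hx).ne'
  have hℓ : ContDiffOn ℝ n (fun x => Real.log (z x)) s := hz.log hne
  have hDℓ : ContDiffOn ℝ m (derivWithin (fun x => Real.log (z x)) s) s :=
    hℓ.derivWithin hs (by exact_mod_cast hmn)
  have hzm : ContDiffOn ℝ m z s := hz.of_le (by exact_mod_cast Nat.le_of_succ_le hmn)
  have hn0 : (n : WithTop ℕ∞) ≠ 0 := by exact_mod_cast (show n ≠ 0 by omega)
  rw [iteratedDerivWithin_succ']
  have hcongr : Set.EqOn (derivWithin z s) (z * derivWithin (fun y => Real.log (z y)) s) s := by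
    intro x hx
    have hd : DifferentiableWithinAt ℝ z s x := hz.differentiableOn hn0 x hx
    rw [Pi.mul_apply, derivWithin.log hd (hne x hx) (hs x hx), ← mul_div_assoc, mul_div_cancel_left₀ _ (hne x hx)]
  rw [iteratedDerivWithin_congr (n := m) hcongr ht, iteratedDerivWithin_mul ht hs (hzm t ht) (hDℓ t ht)]
  refine sum_congr rfl fun i _ => ?_
  rw [iteratedDerivWithin_succ']

/-- **The exponential formula for the derivative moments** (p. 310 display 2 SOLVED by the log-derivatives): for `z > 0`
of class `Cⁿ` within a set `s` of unique differentiability, `t ∈ s`, and every finite index set `V` with `|V| ≤ n`,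
`z^{(|V|)}(t) = z(t) · Σ_{π ∈ 𝒫(V)} Π_{B ∈ π} (log z)^{(|B|)}(t)`
— i.e. the moments `⟨(d/dt)^{|V|}⟩_t = z_t^{(|V|)}/z_t` are the partition sums of the truncated functions `(log z_t)^{(|B|)}`.
[cite: BalabanImbrieJaffe1988, p.310 display 2] -/
theorem iteratedDerivWithin_eq_mul_sum_setPartitions {s : Set ℝ} (hs : UniqueDiffOn ℝ s) {t : ℝ} (ht : t ∈ s)
    {z : ℝ → ℝ} {n : ℕ} (hz : ContDiffOn ℝ n z s) (hpos : ∀ x ∈ s, 0 < z x) (V : Finset α) (hV : V.card ≤ n) :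
    iteratedDerivWithin V.card z s t =
      z t * ∑ π ∈ setPartitions V, ∏ B ∈ π, iteratedDerivWithin B.card (fun x => Real.log (z x)) s t := by
  set ℓ : ℝ → ℝ := fun x => Real.log (z x) with hℓdef
  suffices H : ∀ k, k ≤ n → ∀ W : Finset α, W.card = k →
      iteratedDerivWithin k z s t = z t * ∑ π ∈ setPartitions W, ∏ B ∈ π, iteratedDerivWithin B.card ℓ s t from
    H _ hV V rfl
  intro k
  induction k using Nat.strong_induction_on with
  | _ k ih =>
    intro hk W hWk
    obtain rfl | ⟨m, rfl⟩ : k = 0 ∨ ∃ m, k = m + 1 := by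
      rcases k with _ | m
      · exact Or.inl rfl
      · exact Or.inr ⟨m, rfl⟩
    · rw [card_eq_zero] at hWk
      subst hWk
      rw [setPartitions_empty, sum_singleton, prod_empty, mul_one, iteratedDerivWithin_zero]
    · -- a marked element `v ∈ W`
      obtain ⟨v, hv⟩ : W.Nonempty := card_pos.1 (by omega)
      have hcardE : (W.erase v).card = m := by rw [card_erase_of_mem hv, hWk]; rfl
      -- the analytic side
      rw [iteratedDerivWithin_succ_eq_sum_choose_log hs ht hz hpos hk]
      -- the combinatorial side: marked-block decomposition
      rw [sum_setPartitions_eq_sum_block hv]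
      have hinner : ∀ P₀ ∈ W.powerset.filter (fun P => v ∈ P),
          ∑ ρ ∈ setPartitions (W \ P₀), ∏ B ∈ insert P₀ ρ, iteratedDerivWithin B.card ℓ s t
            = iteratedDerivWithin P₀.card ℓ s t *
                ∑ ρ ∈ setPartitions (W \ P₀), ∏ B ∈ ρ, iteratedDerivWithin B.card ℓ s t := by
        intro P₀ hP₀
        simp only [mem_filter, mem_powerset] at hP₀
        rw [mul_sum]
        refine sum_congr rfl fun ρ hρ => ?_
        rw [prod_insert ((mem_setPartitions.1 hρ).notMem_of_sdiff ⟨v, hP₀.2⟩)]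
      rw [sum_congr rfl hinner, mul_sum]
      -- use the induction hypothesis on `W \ P₀`
      have hIH : ∀ P₀ ∈ W.powerset.filter (fun P => v ∈ P),
          z t * (iteratedDerivWithin P₀.card ℓ s t *
              ∑ ρ ∈ setPartitions (W \ P₀), ∏ B ∈ ρ, iteratedDerivWithin B.card ℓ s t)
            = iteratedDerivWithin P₀.card ℓ s t * iteratedDerivWithin (W \ P₀).card z s t := by
        intro P₀ hP₀
        simp only [mem_filter, mem_powerset] at hP₀
        have hlt : (W \ P₀).card < m + 1 := by
          rw [card_sdiff_of_subset hP₀.1, hWk]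
          have : 0 < P₀.card := card_pos.2 ⟨v, hP₀.2⟩
          omega
        rw [ih _ hlt (by omega) (W \ P₀) rfl]
        ring
      rw [sum_congr rfl hIH, sum_powerset_filter_mem_eq hv]
      -- the summand depends on `P'` only through `|P'|`
      have hcard : ∀ P ∈ (W.erase v).powerset,
          iteratedDerivWithin (insert v P).card ℓ s t * iteratedDerivWithin (W \ insert v P).card z s t
            = iteratedDerivWithin (P.card + 1) ℓ s t * iteratedDerivWithin (m - P.card) z s t := by
        intro P hP
        rw [mem_powerset] at hP
        have hvP : v ∉ P := fun h => notMem_erase v W (hP h)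
        have hPW : insert v P ⊆ W := insert_subset hv (hP.trans (erase_subset v W))
        rw [card_insert_of_notMem hvP, card_sdiff_of_subset hPW, card_insert_of_notMem hvP, hWk]
        congr 2
        omega
      rw [sum_congr rfl hcard,
        sum_powerset_apply_card (fun i => iteratedDerivWithin (i + 1) ℓ s t * iteratedDerivWithin (m - i) z s t), hcardE]
      -- reflect the Leibniz sum `i ↦ m - i`
      rw [← sum_range_reflect]
      refine sum_congr rfl fun i hi => ?_
      have him : i ≤ m := Nat.lt_succ_iff.1 (mem_range.1 hi)
      rw [nsmul_eq_mul, show m + 1 - 1 - i = m - i from by omega, Nat.choose_symm him, Nat.sub_sub_self him]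
      ring

end Analysis


/-! ## §3 Display 2 solved: the truncated functions are the derivatives of `log z_t` -/

section Identification

variable {α : Type*} [DecidableEq α]

/-- **The truncated functions of the `t`-derivative insertions are the log-derivatives.** If `κ` solves display 2 of p. 310
against the derivative moments `⟨(d/dt)^{|K|}⟩_t = z^{(|K|)}(t)/z(t)` for all nonempty `K ⊆ V` (`|V| ≤ n`, `z > 0` of class
`Cⁿ` within `s ∋ t`), then `κ(K) = (log z)^{(|K|)}(t)`: «⟨d/dt; …; d/dt⟩_t» (`|K|` entries) `= (d/dt)^{|K|} log z_t`.
[cite: BalabanImbrieJaffe1988, (5.14.2) p.308; p.310 display 2] -/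
theorem trunc_eq_iteratedDerivWithin_log {s : Set ℝ} (hs : UniqueDiffOn ℝ s) {t : ℝ} (ht : t ∈ s) {z : ℝ → ℝ} {n : ℕ}
    (hz : ContDiffOn ℝ n z s) (hpos : ∀ x ∈ s, 0 < z x) {V : Finset α} (hV : V.card ≤ n) {κ : Finset α → ℝ}
    (hκ : ∀ K ⊆ V, K.Nonempty → iteratedDerivWithin K.card z s t / z t = ∑ π ∈ setPartitions K, ∏ B ∈ π, κ B) :
    ∀ K ⊆ V, K.Nonempty → κ K = iteratedDerivWithin K.card (fun x => Real.log (z x)) s t := by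
  refine trunc_unique (m := fun K => iteratedDerivWithin K.card z s t / z t) hκ fun K hKV _ => ?_
  rw [iteratedDerivWithin_eq_mul_sum_setPartitions hs ht hz hpos K ((card_le_card hKV).trans hV),
    mul_div_cancel_left₀ _ (hpos t ht).ne']

/-- The same with the relations in multiplied-out form `z^{(|K|)}(t) = z(t) · Σ_π Π_B κ(B)`.
[cite: BalabanImbrieJaffe1988, (5.14.2) p.308; p.310 display 2] -/
theorem trunc_eq_iteratedDerivWithin_log' {s : Set ℝ} (hs : UniqueDiffOn ℝ s) {t : ℝ} (ht : t ∈ s) {z : ℝ → ℝ} {n : ℕ}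
    (hz : ContDiffOn ℝ n z s) (hpos : ∀ x ∈ s, 0 < z x) {V : Finset α} (hV : V.card ≤ n) {κ : Finset α → ℝ}
    (hκ : ∀ K ⊆ V, K.Nonempty → iteratedDerivWithin K.card z s t = z t * ∑ π ∈ setPartitions K, ∏ B ∈ π, κ B) :
    ∀ K ⊆ V, K.Nonempty → κ K = iteratedDerivWithin K.card (fun x => Real.log (z x)) s t := by
  refine trunc_eq_iteratedDerivWithin_log hs ht hz hpos hV fun K hKV hK => ?_
  rw [hκ K hKV hK, mul_div_cancel_left₀ _ (hpos t ht).ne']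

/-- The top truncated function: for `|V| = n`, `κ(V) = (log z)^{(n)}(t)`. [cite: BalabanImbrieJaffe1988, (5.14.2) p.308; p.310 display 2] -/
theorem trunc_top_eq_iteratedDerivWithin_log {s : Set ℝ} (hs : UniqueDiffOn ℝ s) {t : ℝ} (ht : t ∈ s) {z : ℝ → ℝ}
    {n : ℕ} (hz : ContDiffOn ℝ n z s) (hpos : ∀ x ∈ s, 0 < z x) {V : Finset α} (hV : V.card = n) (hn : 0 < n)
    {κ : Finset α → ℝ}
    (hκ : ∀ K ⊆ V, K.Nonempty → iteratedDerivWithin K.card z s t / z t = ∑ π ∈ setPartitions K, ∏ B ∈ π, κ B) :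
    κ V = iteratedDerivWithin n (fun x => Real.log (z x)) s t := by
  rw [← hV]
  exact trunc_eq_iteratedDerivWithin_log hs ht hz hpos hV.le hκ V Subset.rfl (card_pos.1 (hV ▸ hn))

end Identification

/-! ## §4 The remainder (5.14.2): the weight `(n̄+1)!` versus Taylor's `n̄!` -/

section Remainder

variable {ι : Type*} [Fintype ι] [DecidableEq ι]

/-- `[0,1]` (as `uIcc 0 1`, the interval of r16's `pertP`/`taylor_logz`) is a set of unique differentiability. [folklore]
[cite: BalabanImbrieJaffe1988, (5.14.2) p.308] -/
theorem uniqueDiffOn_uIcc01 : UniqueDiffOn ℝ (Set.uIcc (0 : ℝ) 1) := by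
  rw [Set.uIcc_of_le zero_le_one]; exact uniqueDiffOn_Icc zero_lt_one

/-- **`⟨d/dt; …; d/dt⟩_t = (d/dt)^{n̄+1} log z_t` on `[0, 1]`.** `H` a set of `n̄ + 1` derivative labels; `z > 0` of class
`C^{n̄+1}` on `[0,1]` (one-sided derivatives at the ends, `iteratedDerivWithin … (uIcc 0 1)` as in r16's `pertP`/`taylor_logz`);
for each `t`, `κ_t` solves display 2 against the moments `z^{(|K|)}(t)/z(t)`, `∅ ≠ K ⊆ H`. Then the truncated expectation of all
`n̄ + 1` insertions is the `(n̄+1)`-st log-derivative. [cite: BalabanImbrieJaffe1988, (5.14.2) p.308; p.310 display 2] -/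
theorem trunc_univ_eq_iteratedDerivWithin_log {nbar : ℕ} (hH : Fintype.card ι = nbar + 1) {z : ℝ → ℝ}
    (hz : ContDiffOn ℝ (nbar + 1 : ℕ) z (Set.uIcc 0 1)) (hpos : ∀ t ∈ Set.uIcc (0 : ℝ) 1, 0 < z t)
    {κ : ℝ → Finset ι → ℝ}
    (hκ : ∀ t ∈ Set.uIcc (0 : ℝ) 1, ∀ K : Finset ι, K.Nonempty →
      iteratedDerivWithin K.card z (Set.uIcc 0 1) t / z t = ∑ π ∈ setPartitions K, ∏ B ∈ π, κ t B)
    {t : ℝ} (ht : t ∈ Set.uIcc (0 : ℝ) 1) :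
    κ t univ = iteratedDerivWithin (nbar + 1) (fun x => Real.log (z x)) (Set.uIcc 0 1) t :=
  trunc_top_eq_iteratedDerivWithin_log uniqueDiffOn_uIcc01 ht hz hpos (by rw [card_univ, hH]) (Nat.succ_pos _)
    fun K _ hK => hκ t ht K hK

/-- **r16's printed remainder `remR` of (5.14.2), fed with the display-2 truncated expectation, is the Taylor remainder divided
by `n̄ + 1`:** `ℛ_k^{printed} = ∫₀¹ −((1−t)^{n̄}/(n̄+1)!) ⟨d/dt;…;d/dt⟩_t dt`
`= −(1/(n̄+1)) ∫₀¹ ((1−t)^{n̄}/n̄!) (d/dt)^{n̄+1} log z_t dt`.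
(Kernel side of the TRANSCRIPTION NOTE recorded in `BIJ88Sect5StatementsPart4.remR`.) [cite: BalabanImbrieJaffe1988, (5.14.2) p.308] -/
theorem remR_trunc_eq {nbar : ℕ} (hH : Fintype.card ι = nbar + 1) {z : ℝ → ℝ}
    (hz : ContDiffOn ℝ (nbar + 1 : ℕ) z (Set.uIcc 0 1)) (hpos : ∀ t ∈ Set.uIcc (0 : ℝ) 1, 0 < z t)
    {κ : ℝ → Finset ι → ℝ}
    (hκ : ∀ t ∈ Set.uIcc (0 : ℝ) 1, ∀ K : Finset ι, K.Nonempty →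
      iteratedDerivWithin K.card z (Set.uIcc 0 1) t / z t = ∑ π ∈ setPartitions K, ∏ B ∈ π, κ t B) :
    remR (fun t => κ t univ) nbar = -(1 / (nbar + 1 : ℝ)) *
      ∫ t in (0 : ℝ)..1, ((1 - t) ^ nbar / nbar.factorial) *
        iteratedDerivWithin (nbar + 1) (fun x => Real.log (z x)) (Set.uIcc 0 1) t := by
  rw [remR, ← intervalIntegral.integral_const_mul]
  refine intervalIntegral.integral_congr fun t ht => ?_
  rw [trunc_univ_eq_iteratedDerivWithin_log hH hz hpos hκ ht, Nat.factorial_succ]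
  push_cast
  have hf : (nbar.factorial : ℝ) ≠ 0 := by exact_mod_cast nbar.factorial_ne_zero
  have hn : ((nbar : ℝ) + 1) ≠ 0 := Nat.cast_add_one_ne_zero nbar
  field_simp

/-- **(5.14.2) with the printed weight is off by the located factor `n̄ + 1`:** with `⟨d/dt;…;d/dt⟩_t` the display-2 truncated
expectation, `log z₁ = log z₀ − 𝒫̃_{k+1} − (n̄+1)·ℛ_k^{printed}` (r16's `logz_split` needs `trunc = (n̄+1)·(d/dt)^{n̄+1} log z_t`;
here that hypothesis is DISCHARGED up to the factor). [cite: BalabanImbrieJaffe1988, (5.14.2) p.308] -/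
theorem logz_split_trunc {nbar : ℕ} (hH : Fintype.card ι = nbar + 1) {z : ℝ → ℝ}
    (hz : ContDiffOn ℝ (nbar + 1 : ℕ) z (Set.uIcc 0 1)) (hpos : ∀ t ∈ Set.uIcc (0 : ℝ) 1, 0 < z t)
    {κ : ℝ → Finset ι → ℝ}
    (hκ : ∀ t ∈ Set.uIcc (0 : ℝ) 1, ∀ K : Finset ι, K.Nonempty →
      iteratedDerivWithin K.card z (Set.uIcc 0 1) t / z t = ∑ π ∈ setPartitions K, ∏ B ∈ π, κ t B) :
    Real.log (z 1) = Real.log (z 0) - pertP (fun x => Real.log (z x)) nbar - (nbar + 1 : ℝ) * remR (fun t => κ t univ) nbar := by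
  have hℓ : ContDiffOn ℝ (nbar + 1 : ℕ) (fun x => Real.log (z x)) (Set.uIcc 0 1) := hz.log fun x hx => (hpos x hx).ne'
  have ht := taylor_logz (nbar := nbar) hℓ
  rw [remR_trunc_eq hH hz hpos hκ]
  have hn : ((nbar : ℝ) + 1) ≠ 0 := Nat.cast_add_one_ne_zero nbar
  rw [ht]
  field_simp
  ring

/-- **(5.14.2) holds exactly with the weight `(1−t)^{n̄}/n̄!`:**
`log z₁ = log z₀ − 𝒫̃_{k+1} − ∫₀¹ −((1−t)^{n̄}/n̄!) ⟨d/dt;…;d/dt⟩_t dt`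
— the sentence p. 308 *"z_F = (z_F/z) exp(log z) … we give expansions for z_F/z and log z … the second to 𝒫^L_{k+1,loc} plus
remainders"* with the display-2 truncated expectation and Taylor's weight. [cite: BalabanImbrieJaffe1988, (5.14.2) p.308] -/
theorem eq5142_taylorWeight {nbar : ℕ} (hH : Fintype.card ι = nbar + 1) {z : ℝ → ℝ}
    (hz : ContDiffOn ℝ (nbar + 1 : ℕ) z (Set.uIcc 0 1)) (hpos : ∀ t ∈ Set.uIcc (0 : ℝ) 1, 0 < z t)
    {κ : ℝ → Finset ι → ℝ}
    (hκ : ∀ t ∈ Set.uIcc (0 : ℝ) 1, ∀ K : Finset ι, K.Nonempty →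
      iteratedDerivWithin K.card z (Set.uIcc 0 1) t / z t = ∑ π ∈ setPartitions K, ∏ B ∈ π, κ t B) :
    Real.log (z 1) = Real.log (z 0) - pertP (fun x => Real.log (z x)) nbar
      - ∫ t in (0 : ℝ)..1, -((1 - t) ^ nbar / nbar.factorial) * κ t univ := by
  have hℓ : ContDiffOn ℝ (nbar + 1 : ℕ) (fun x => Real.log (z x)) (Set.uIcc 0 1) := hz.log fun x hx => (hpos x hx).ne'
  have hint : ∫ t in (0 : ℝ)..1, -((1 - t) ^ nbar / nbar.factorial) * κ t univ
      = -∫ t in (0 : ℝ)..1, ((1 - t) ^ nbar / nbar.factorial) *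
          iteratedDerivWithin (nbar + 1) (fun x => Real.log (z x)) (Set.uIcc 0 1) t := by
    rw [← intervalIntegral.integral_neg]
    refine intervalIntegral.integral_congr fun t ht => ?_
    rw [trunc_univ_eq_iteratedDerivWithin_log hH hz hpos hκ ht]
    ring
  rw [hint, taylor_logz (nbar := nbar) hℓ]
  ring

end Remainder

/-! ## §5  Bridge to the Möbius-inversion vocabulary of `Literature.Probability.LatticeModels`: the display-2 truncated functions of
## the derivative moments are their URSELL FUNCTION `ursellOf`, and EXPLICITLY `(log z)⁽ⁿ⁾ = Σ_π (−1)^{|π|−1}(|π|−1)! Π_{P∈π} z^{(|P|)}/z` -/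

section Ursell

open Literature.Probability.LatticeModels (ursellOf eq_ursellOf_of_forall ursellOf_eq_sum_setPartitions)

variable {α : Type*} [Fintype α] [DecidableEq α]

/-- **Display 2 = Möbius inversion**: for `z > 0` of class `Cⁿ` within `s ∋ t` and at most `n` labels, the Ursell function
(`LatticeModels.ursellOf`, Ruelle's `Γ⁻¹`) of the derivative-moment function `K ↦ ⟨(d/dt)^{|K|}⟩_t = z^{(|K|)}(t)/z(t)` at a nonempty `K`
is `(log z)^{(|K|)}(t)` — the truncated expectation `⟨d/dt; …; d/dt⟩_t` of p.308.
[cite: BalabanImbrieJaffe1988, (5.14.2) p.308; p.310 display 2] -/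
theorem ursellOf_derivMoments_eq_iteratedDerivWithin_log {s : Set ℝ} (hs : UniqueDiffOn ℝ s) {t : ℝ} (ht : t ∈ s) {z : ℝ → ℝ}
    {n : ℕ} (hz : ContDiffOn ℝ n z s) (hpos : ∀ x ∈ s, 0 < z x) (hα : Fintype.card α ≤ n) {K : Finset α} (hK : K.Nonempty) :
    ursellOf (fun W : Finset α => iteratedDerivWithin W.card z s t / z t) K =
      iteratedDerivWithin K.card (fun x => Real.log (z x)) s t := by
  refine (eq_ursellOf_of_forall (fun W : Finset α => iteratedDerivWithin W.card z s t / z t)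
    (fun W => iteratedDerivWithin W.card (fun x => Real.log (z x)) s t) (fun W _ => ?_) hK).symm
  rw [iteratedDerivWithin_eq_mul_sum_setPartitions hs ht hz hpos W ((card_le_univ W).trans hα),
    mul_div_cancel_left₀ _ (hpos t ht).ne']

/-- **The truncated expectation EXPLICITLY in the moments (all orders)**: for `z > 0` of class `Cⁿ` within `s ∋ t` and a nonempty `K`
with at most `n` labels available,
`(log z)^{(|K|)}(t) = Σ_{π ∈ 𝒫(K)} (−1)^{|π|−1} (|π|−1)! Π_{P∈π} z^{(|P|)}(t)/z(t)`
(Faà di Bruno for `log ∘ z` in set-partition form; `|K| = 2`: `(log z)'' = z''/z − (z'/z)²`) — the Möbius function of the partition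
lattice, `LatticeModels.ursellOf_eq_sum_setPartitions`. [cite: BalabanImbrieJaffe1988, (5.14.2) p.308; p.310 display 2] -/
theorem iteratedDerivWithin_log_eq_sum_setPartitions_moebius {s : Set ℝ} (hs : UniqueDiffOn ℝ s) {t : ℝ} (ht : t ∈ s)
    {z : ℝ → ℝ} {n : ℕ} (hz : ContDiffOn ℝ n z s) (hpos : ∀ x ∈ s, 0 < z x) (hα : Fintype.card α ≤ n) {K : Finset α}
    (hK : K.Nonempty) : iteratedDerivWithin K.card (fun x => Real.log (z x)) s t = ∑ π ∈ setPartitions K,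
      (-1 : ℝ) ^ (π.card - 1) * ((π.card - 1).factorial : ℝ) * ∏ P ∈ π, (iteratedDerivWithin P.card z s t / z t) := by
  rw [← ursellOf_derivMoments_eq_iteratedDerivWithin_log hs ht hz hpos hα hK]
  exact ursellOf_eq_sum_setPartitions _ (by simp [div_self (hpos t ht).ne']) hK

/-- The same for `n` derivatives with the labels `Fin n`: `(log z)⁽ⁿ⁾(t) = Σ_{π ∈ 𝒫({1,…,n})} (−1)^{|π|−1}(|π|−1)! Π_{P∈π} z^{(|P|)}(t)/z(t)`
(`n ≥ 1`). [cite: BalabanImbrieJaffe1988, (5.14.2) p.308; p.310 display 2] -/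
theorem iteratedDerivWithin_log_eq_sum_setPartitions_fin {s : Set ℝ} (hs : UniqueDiffOn ℝ s) {t : ℝ} (ht : t ∈ s)
    {z : ℝ → ℝ} {n : ℕ} (hn : 0 < n) (hz : ContDiffOn ℝ n z s) (hpos : ∀ x ∈ s, 0 < z x) :
    iteratedDerivWithin n (fun x => Real.log (z x)) s t = ∑ π ∈ setPartitions (univ : Finset (Fin n)),
      (-1 : ℝ) ^ (π.card - 1) * ((π.card - 1).factorial : ℝ) * ∏ P ∈ π, (iteratedDerivWithin P.card z s t / z t) := by
  haveI : Nonempty (Fin n) := ⟨⟨0, hn⟩⟩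
  have h := iteratedDerivWithin_log_eq_sum_setPartitions_moebius hs ht hz hpos (α := Fin n) (by rw [Fintype.card_fin])
    (univ_nonempty (α := Fin n))
  rwa [card_univ, Fintype.card_fin] at h

end Ursell

end Literature.MathematicalPhysics.QuantumFieldTheory.BalabanImbrieJaffe1984to88.BIJ88TruncatedExpectation5142
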